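import Literature.Analysis.InnerProduct.LensSpaceIsospectralRigidityOddCoprime
import HarnessLib

/-!
# Ikeda–Yamamoto's Main Theorem for a prime-power order `q = l^ν` of the fundamental group: two isospectral
# three-dimensional lens spaces `L(q; p₁, p₂)`, `L(q; p₁', p₂')` are isometric (Ikeda–Yamamoto 1979, §7)

Layer `Literature/Analysis/InnerProduct`, namespace `Literature.Analysis.InnerProduct`; lane `lit-hodgefound`, prover seat
`lit-hodgefound-p06`, generation 45, row g45-#6. THEOREMS only (no definition, no instance, no notation, no named fact).
Companion of `LensSpaceIsospectralRigidityPrime.lean` (row g45-#2, `q` prime, Lemma 5.3 in the signed-indicator form),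
`LensSpaceGeneratingFunctionDoublePoles.lean` (row g45-#3, Lemma 4.4 / Corollary 4.5 / (4.18)) and
`LensSpaceIsospectralRigidityOddCoprime.lean` (row g45-#5, the first case `(p₁ ± 1, q) = 1` of §7).

## Source, verbatim (held text `paper:doi-10-18910-4811`)

A. Ikeda, Y. Yamamoto, *On the spectra of 3-dimensional lens spaces*, Osaka J. Math. **16** (1979) 447–469, §7 (p. 460–463):
"**7. Proof of Main Theorem for `q = l^ν` (`l` is an odd prime and `ν ≥ 2`).** In the case `(p₁ + 1, q) = (p₁ − 1, q) = 1`,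
we can prove in the same way as in 6. Since `L(q : p₁)` (resp. `L(q : p₂)`) is isometric to `L(q : q − p₁)` (resp.
`L(q : q − p₂)`), by Lemma 4.4, we may assume (7.1) `(p₁ + 1, q) = (p₂ + 1, q) = l^μ`, where `ν > μ ≥ 1`. Since `l` is an odd
prime, we have `(pᵢ − 1, q) = 1`. … Since `k = 1` and `k = l^{ν−μ} − 1` satisfy (4.13) and (4.14), by Corollary 4.7, we have
(7.3), (7.4) [the relation (4.18) for these two `k`]. Taking the sum of (7.3) and (7.4), we have
(7.5) `−cot(π(p₁−1)/q) − cot(π(p₁−1)k/q) − cot(π(p₁*−1)/q) − cot(π(p₁*−1)k/q)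
      = −cot(π(p₂−1)/q) − cot(π(p₂−1)k/q) − cot(π(p₂*−1)/q) − cot(π(p₂*−1)k/q)`.
Since `k` is prime to `q`, all the integers `p₁ − 1, (p₁ − 1)k, p₁* − 1, (p₁* − 1)k, p₂ − 1, (p₂ − 1)k, p₂* − 1` and
`(p₂* − 1)k` are prime to `q`. Suppose `p₁ ≢ ±p₂ (mod q)` and `p₁ ≢ ±p₂* (mod q)`. Then applying Lemma 5.3 to (7.5), only
the following cases are possible (7.6) `p₁ − 1 ≡ −(p₁ − 1)k`, (7.7) `p₁ − 1 ≡ −(p₁* − 1)`, (7.8) `p₁ − 1 ≡ −(p₁* − 1)k`,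
(7.9) `p₁ − 1 ≡ (p₂ − 1)k`, (7.10) `p₁ − 1 ≡ (p₂* − 1)k (mod q)`. … [(7.11)–(7.18): case (7.8) forces `p₁ ≡ k` and then
`p₁ ≡ p₂` or `p₁ ≡ p₂*`] … (7.19) Each two members of the first four terms (resp. the second four terms) in (7.5) do not
cancel to each other. … [(7.20)–(7.28): case (7.9) forces `k² ≡ 1`, impossible as `(k + 1)(k − 1) ≢ 0`, or `p₁ ≡ p₂*`] …
Thus, the case (7.9) can not happen. In the same way as for the above, we can see the case (7.10) can not happen. q.e.d."

## The proof, as formalised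

Write `q = ml` (`m = q/l`), `K = m − 1` ("`k = l^{ν−μ} − 1`"; we take `μ = 1` throughout, which the argument allows: only
`l ∣ pᵢ + 1` is used, through `q ∣ m(pᵢ + 1)`), and in `ℤ/q`: `P = p₁`, `U = p₁*`, `Q = p₂`, `V = p₂*`, `a = P − 1`,
`b = U − 1 = −Ua`, `c = Q − 1`, `d = V − 1 = −Vc`.
* §1 (7.5): for `q ∣ (K + 1)t` one has `Kt ≡ −t`, so `cot(πKt/q) = −cot(πt/q)`; adding (4.18) at `k = 1` and at `k = K`
  (row g45-#3's `cot_alternatingSum_eq_of_lensMultiplicity_eq'`, whose hypotheses (4.13)/(4.14) hold for both) the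
  `(pᵢ + 1)`-terms cancel and (7.5) remains: `∑_{s ∈ S₁} cot(πs̃/q) = ∑_{s ∈ S₂} cot(πs̃/q)` with `S₁ = (a, Ka, b, Kb)`,
  `S₂ = (c, Kc, d, Kd)`, eight units (`cot_pairSum_eq_of_lensMultiplicity_eq`). "Applying Lemma 5.3" (row g45-#2's
  `sum_signedIndicator_eq_zero_of_sum_mul_cot_eq_zero`, i.e. the theorem of Chowla–Okada of the tree) gives the vanishing
  signed indicator: for every `y ∈ ℤ/q`, `∑_{s ∈ S₁} ([y = s] − [y = −s]) = ∑_{s ∈ S₂} ([y = s] − [y = −s])`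
  (`signedIndicator_pair_eq_of_lensMultiplicity_eq`).
* §2 the combinatorics (7.6)–(7.28), from the signed-indicator identity alone, for `K` a unit with `K + 1 ≠ 0` and
  `(K + 1)(K − 1) ≠ 0` in `ℤ/q` (here: `m ≢ 0` and `m(m − 2) ≢ 0 (mod q)`, as `l ∤ m − 2`): reading the identity at `y = a`
  gives the source's alternative (7.6)–(7.10) (`a ∈ S₂ ∪ −S₁`), of which (7.6), (7.7) are void; (7.8) (`KU = 1`, i.e.
  `p₁ ≡ k`; then `Kb = −a` and the identity read at `y = Kc`, `y = Kd` forces `Kc = b = Kd`, `c = d`, `p₂* ≡ −1`) is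
  `false_of_signedIndicator_pair_eq_of_mul_eq_one`, applied four times (to `(P, U)`, `(U, P)`, `(Q, V)`, `(V, Q)`: the
  identity is symmetric) to obtain (7.19); under (7.19) the identity read at `y = a, Ka, c, Kc` leaves (7.9)/(7.10) with
  their companions (7.20)/(7.21), which force `K² = 1` or `p₁p₂ ≡ 1` (`false_of_signedIndicator_pair_eq`). Conclusion
  (`eq_or_eq_of_signedIndicator_pair_eq`): `Q = P` or `Q = U`, i.e. `p₂ ≡ p₁` or `p₁p₂ ≡ 1 (mod q)`.
* §3 THE MAIN THEOREM: for `q` odd, `l` an odd prime with `l² ∣ q`, `l ∣ p₁ + 1`, `l ∣ p₂ + 1` and `L(q; 1, p₁)`,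
  `L(q; 1, p₂)` isospectral and not homogeneous, `p₁ ≡ p₂` or `p₁p₂ ≡ 1 (mod q)`
  (`dvd_of_lensMultiplicity_one_eq_of_dvd_add_one`); for `q = l^ν` all cases together — homogeneous (the tree's Corollary
  3.4), `(p₁ ± 1, q) = 1` (row g45-#5), `l ∣ p₁ ± 1` (Lemma 4.4 moves `p₂` to `±p₂` with `l ∣ p₂ + 1`) —
  `dvd_of_lensMultiplicity_one_eq_of_prime_pow`; general weights `dvd_of_lensMultiplicity_eq_of_prime_pow`; and
  ISOSPECTRAL ⟺ ISOMETRIC for `q = l^ν` (`lensMultiplicity_eq_iff_lensWeightsEquivalent_of_prime_pow`).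

## References

* [IkedaYamamoto1979] A. Ikeda, Y. Yamamoto, *On the spectra of 3-dimensional lens spaces*, Osaka J. Math. 16 (1979) 447–469:
  Main Theorem (`q = l^ν`), §7 (7.1)–(7.28), Lemma 4.4, Corollary 4.5, Corollary 4.7 (4.18), Lemma 5.3, Proposition 4.1,
  Proposition 1.1.
* [Okada1981] T. Okada, *On an extension of a theorem of S. Chowla*, Acta Arith. 38 (1980/81) 341–345 (Lemma 5.3 for all `q`).
* [Ikeda1980] A. Ikeda, *On lens spaces which are isospectral but not isometric*, Ann. Sci. ÉNS (4) 13 (1980) 303–315,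
  Theorem 2.1 (the isometry criterion `LensWeightsEquivalent`).
-/

noncomputable section

open Finset Filter Topology Complex

namespace Literature.Analysis.InnerProduct

open _root_.Real _root_.Filter _root_.Topology

/-! ### §1 The relation (7.5) and its signed-indicator form -/

/-- `cot(πt/q) = cot(πt̃/q)` with `t̃ ∈ [0, q)` the representative of `t mod q`. [folklore] -/
private theorem cot_intCast_eq_cot_val_pp {q : ℕ} [NeZero q] (t : ℤ) :
    Complex.cot (π * t / q) = Complex.cot (π * (((t : ZMod q).val : ℕ) : ℂ) / q) := by
  have hq : (q : ℂ) ≠ 0 := Nat.cast_ne_zero.mpr (NeZero.ne q)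
  obtain ⟨m, hm⟩ : (q : ℤ) ∣ t - (((t : ZMod q).val : ℕ) : ℤ) := by
    rw [← ZMod.intCast_zmod_eq_zero_iff_dvd]
    push_cast
    rw [ZMod.natCast_zmod_val, sub_self]
  have he : cexp (2 * π * I * t / q) = cexp (2 * π * I * ((((t : ZMod q).val : ℕ) : ℤ) : ℂ) / q) := by
    rw [Complex.exp_eq_exp_iff_exists_int]
    refine ⟨m, ?_⟩
    have ht : (t : ℂ) = ((((t : ZMod q).val : ℕ) : ℤ) : ℂ) + (q : ℂ) * (m : ℂ) := by
      exact_mod_cast (show t = (((t : ZMod q).val : ℕ) : ℤ) + q * m by linear_combination hm)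
    rw [ht]
    field_simp
  have h1 := I_mul_cot_eq_ratio q t
  have h2 := I_mul_cot_eq_ratio q ((((t : ZMod q).val : ℕ) : ℤ))
  rw [he] at h1
  push_cast at h1 h2
  exact mul_left_cancel₀ I_ne_zero (h1.trans h2.symm)

/-- `cot(π(−x)~/q) = −cot(πx̃/q)` on `ℤ/q` (`(−x)~ = q − x̃` for `x ≠ 0`; `cot 0 = 0`). [folklore] -/
private theorem cot_neg_val_pp {q : ℕ} [NeZero q] (x : ZMod q) :
    Complex.cot (π * ((-x).val : ℂ) / q) = -Complex.cot (π * (x.val : ℂ) / q) := by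
  have hq : (q : ℂ) ≠ 0 := Nat.cast_ne_zero.mpr (NeZero.ne q)
  by_cases hx : x = 0
  · subst hx
    simp [Complex.cot_eq_cos_div_sin]
  rw [ZMod.neg_val, if_neg hx, Nat.cast_sub (ZMod.val_lt x).le,
    show (π : ℂ) * ((q : ℂ) - (x.val : ℂ)) / q = π - π * (x.val : ℂ) / q by field_simp,
    Complex.cot_eq_cos_div_sin, Complex.cot_eq_cos_div_sin, Complex.cos_pi_sub, Complex.sin_pi_sub, neg_div]

/-- **The cancellation behind (7.5)**: if `q ∣ (K + 1)t` then `Kt ≡ −t (mod q)` and `cot(πKt/q) = −cot(πt/q)`.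
[cite: IkedaYamamoto1979, §7 ("taking the sum of (7.3) and (7.4)")] -/
theorem cot_mul_eq_neg_cot_of_dvd {q : ℕ} [NeZero q] {K t : ℤ} (h : (q : ℤ) ∣ (K + 1) * t) :
    Complex.cot (π * ((K * t : ℤ) : ℂ) / q) = -Complex.cot (π * (t : ℂ) / q) := by
  have hKt : ((K * t : ℤ) : ZMod q) = -(t : ZMod q) := by
    have h0 := (ZMod.intCast_zmod_eq_zero_iff_dvd _ q).mpr h
    push_cast at h0 ⊢
    linear_combination h0
  rw [cot_intCast_eq_cot_val_pp (q := q) (K * t), cot_intCast_eq_cot_val_pp (q := q) t, hKt, cot_neg_val_pp]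

/-- **The relation (7.5) (Ikeda–Yamamoto 1979).** Let `L(q; 1, p₁)` and `L(q; 1, p₂)` be isospectral, `pᵢpᵢ* ≡ 1 (mod q)`,
`q ∤ 2`, `q ∤ p₁ ± 1`, and let `K` satisfy `q ∤ 2K`, `q ∤ K(p₁ ± 1)` ((4.13)/(4.14) for `k = 1` and `k = K`) and
`q ∣ (K + 1)(p₁ + 1)`, `q ∣ (K + 1)(p₂ + 1)` (in the source `K = l^{ν−μ} − 1`, `(pᵢ + 1, q) = l^μ`). Then the sum of (4.18)
at `k = 1` and at `k = K` is (7.5):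
`cot(π(p₁−1)/q) + cot(πK(p₁−1)/q) + cot(π(p₁*−1)/q) + cot(πK(p₁*−1)/q) = ` the same for `p₂`
(the `(pᵢ + 1)`- and `(pᵢ* + 1)`-terms of the two relations cancel, as `cot(πK(p+1)/q) = −cot(π(p+1)/q)`).
[cite: IkedaYamamoto1979, §7 (7.3)–(7.5), Corollary 4.7 (4.18)] -/
theorem cot_pairSum_eq_of_lensMultiplicity_eq {q : ℕ} [NeZero q] {K p₁ u₁ p₂ u₂ : ℤ}
    (hu₁ : (q : ℤ) ∣ u₁ * p₁ - 1) (hu₂ : (q : ℤ) ∣ u₂ * p₂ - 1) (h2 : ¬ (q : ℤ) ∣ 2) (h2K : ¬ (q : ℤ) ∣ 2 * K)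
    (hm₁ : ¬ (q : ℤ) ∣ p₁ - 1) (hp₁ : ¬ (q : ℤ) ∣ p₁ + 1) (hmK : ¬ (q : ℤ) ∣ K * (p₁ - 1))
    (hpK : ¬ (q : ℤ) ∣ K * (p₁ + 1)) (hK₁ : (q : ℤ) ∣ (K + 1) * (p₁ + 1)) (hK₂ : (q : ℤ) ∣ (K + 1) * (p₂ + 1))
    (h : ∀ n : ℕ, lensMultiplicity q 1 p₁ n = lensMultiplicity q 1 p₂ n) :
    Complex.cot (π * ((p₁ - 1 : ℤ) : ℂ) / q) + Complex.cot (π * ((K * (p₁ - 1) : ℤ) : ℂ) / q) +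
        (Complex.cot (π * ((u₁ - 1 : ℤ) : ℂ) / q) + Complex.cot (π * ((K * (u₁ - 1) : ℤ) : ℂ) / q)) =
      Complex.cot (π * ((p₂ - 1 : ℤ) : ℂ) / q) + Complex.cot (π * ((K * (p₂ - 1) : ℤ) : ℂ) / q) +
        (Complex.cot (π * ((u₂ - 1 : ℤ) : ℂ) / q) + Complex.cot (π * ((K * (u₂ - 1) : ℤ) : ℂ) / q)) := by
  -- (7.3): (4.18) at `k = 1`
  have r1 := cot_alternatingSum_eq_of_lensMultiplicity_eq' (k := 1) hu₁ hu₂ (by rwa [mul_one])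
    (by rwa [one_mul]) (by rwa [one_mul]) h
  simp only [one_mul] at r1
  -- (7.4): (4.18) at `k = K`
  have rK := cot_alternatingSum_eq_of_lensMultiplicity_eq' (k := K) hu₁ hu₂ h2K hmK hpK h
  -- `q ∣ (K + 1)(pᵢ* + 1)` as `pᵢ* + 1 ≡ pᵢ*(pᵢ + 1)`
  have hKu₁ : (q : ℤ) ∣ (K + 1) * (u₁ + 1) := by
    have : (K + 1) * (u₁ + 1) = u₁ * ((K + 1) * (p₁ + 1)) - (K + 1) * (u₁ * p₁ - 1) := by ring
    rw [this]
    exact dvd_sub (dvd_mul_of_dvd_right hK₁ _) (dvd_mul_of_dvd_right hu₁ _)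
  have hKu₂ : (q : ℤ) ∣ (K + 1) * (u₂ + 1) := by
    have : (K + 1) * (u₂ + 1) = u₂ * ((K + 1) * (p₂ + 1)) - (K + 1) * (u₂ * p₂ - 1) := by ring
    rw [this]
    exact dvd_sub (dvd_mul_of_dvd_right hK₂ _) (dvd_mul_of_dvd_right hu₂ _)
  rw [cot_mul_eq_neg_cot_of_dvd hK₁, cot_mul_eq_neg_cot_of_dvd hK₂, cot_mul_eq_neg_cot_of_dvd hKu₁,
    cot_mul_eq_neg_cot_of_dvd hKu₂] at rK
  push_cast at r1 rK ⊢
  linear_combination -(r1 + rK)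

/-- **"Applying Lemma 5.3 to (7.5)": the signed-indicator identity.** In the situation of (7.5), if moreover `p₁ − 1`,
`p₂ − 1` and `K` are prime to `q` (so that all eight arguments of (7.5) are units mod `q`: `pᵢ* − 1 ≡ −pᵢ*(pᵢ − 1)`) and
`q ≥ 3`, then with `P = p₁`, `U = p₁*`, `Q = p₂`, `V = p₂*`, `K` read in `ℤ/q`, for every `y ∈ ℤ/q` the total signed weight
of the class `{y, −y}` on the two sides of (7.5) agrees:
`∑_{s ∈ (P−1, K(P−1), U−1, K(U−1))} ([y = s] − [y = −s]) = ∑_{s ∈ (Q−1, K(Q−1), V−1, K(V−1))} ([y = s] − [y = −s])`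
(the theorem of Chowla–Okada = Lemma 5.3, in the form `sum_signedIndicator_eq_zero_of_sum_mul_cot_eq_zero` of row g45-#2).
[cite: IkedaYamamoto1979, §7 ("applying Lemma 5.3 to (7.5)"), Lemma 5.3] [cite: Okada1981, Theorem] -/
theorem signedIndicator_pair_eq_of_lensMultiplicity_eq {q : ℕ} [NeZero q] (hq : 2 < q) {K p₁ u₁ p₂ u₂ : ℤ}
    (hu₁ : (q : ℤ) ∣ u₁ * p₁ - 1) (hu₂ : (q : ℤ) ∣ u₂ * p₂ - 1) (h2 : ¬ (q : ℤ) ∣ 2)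
    (hm₁ : IsCoprime (p₁ - 1) q) (hm₂ : IsCoprime (p₂ - 1) q) (hp₁ : ¬ (q : ℤ) ∣ p₁ + 1) (hK : IsCoprime K q)
    (hK₁ : (q : ℤ) ∣ (K + 1) * (p₁ + 1)) (hK₂ : (q : ℤ) ∣ (K + 1) * (p₂ + 1))
    (h : ∀ n : ℕ, lensMultiplicity q 1 p₁ n = lensMultiplicity q 1 p₂ n) (y : ZMod q) :
    ((if y = (p₁ : ZMod q) - 1 then (1 : ℤ) else 0) - (if y = -((p₁ : ZMod q) - 1) then 1 else 0)) +
        ((if y = (K : ZMod q) * ((p₁ : ZMod q) - 1) then (1 : ℤ) else 0) -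
          (if y = -((K : ZMod q) * ((p₁ : ZMod q) - 1)) then 1 else 0)) +
        ((if y = (u₁ : ZMod q) - 1 then (1 : ℤ) else 0) - (if y = -((u₁ : ZMod q) - 1) then 1 else 0)) +
        ((if y = (K : ZMod q) * ((u₁ : ZMod q) - 1) then (1 : ℤ) else 0) -
          (if y = -((K : ZMod q) * ((u₁ : ZMod q) - 1)) then 1 else 0)) =
      ((if y = (p₂ : ZMod q) - 1 then (1 : ℤ) else 0) - (if y = -((p₂ : ZMod q) - 1) then 1 else 0)) +
        ((if y = (K : ZMod q) * ((p₂ : ZMod q) - 1) then (1 : ℤ) else 0) -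
          (if y = -((K : ZMod q) * ((p₂ : ZMod q) - 1)) then 1 else 0)) +
        ((if y = (u₂ : ZMod q) - 1 then (1 : ℤ) else 0) - (if y = -((u₂ : ZMod q) - 1) then 1 else 0)) +
        ((if y = (K : ZMod q) * ((u₂ : ZMod q) - 1) then (1 : ℤ) else 0) -
          (if y = -((K : ZMod q) * ((u₂ : ZMod q) - 1)) then 1 else 0)) := by
  classical
  haveI : Nontrivial (ZMod q) := ZMod.nontrivial_iff.mpr (by omega)
  -- units of `ℤ/q`
  have unit_of : ∀ {t : ℤ}, IsCoprime t q → IsUnit (t : ZMod q) := fun ht ↦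
    (ZMod.coe_int_isUnit_iff_isCoprime _ _).mpr ht.symm
  have not_dvd_of_unit : ∀ {t : ℤ}, IsUnit (t : ZMod q) → ¬ (q : ℤ) ∣ t := fun ht hd ↦
    ht.ne_zero ((ZMod.intCast_zmod_eq_zero_iff_dvd _ _).mpr hd)
  have hUP : (u₁ : ZMod q) * (p₁ : ZMod q) = 1 := by
    have h0 := (ZMod.intCast_zmod_eq_zero_iff_dvd (u₁ * p₁ - 1) q).mpr hu₁
    push_cast at h0
    exact sub_eq_zero.mp h0
  have hVQ : (u₂ : ZMod q) * (p₂ : ZMod q) = 1 := by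
    have h0 := (ZMod.intCast_zmod_eq_zero_iff_dvd (u₂ * p₂ - 1) q).mpr hu₂
    push_cast at h0
    exact sub_eq_zero.mp h0
  have hKu : IsUnit (K : ZMod q) := unit_of hK
  have ha : IsUnit ((p₁ : ZMod q) - 1) := by have := unit_of hm₁; push_cast at this; exact this
  have hc : IsUnit ((p₂ : ZMod q) - 1) := by have := unit_of hm₂; push_cast at this; exact this
  have hU : IsUnit (u₁ : ZMod q) := IsUnit.of_mul_eq_one _ hUP
  have hV : IsUnit (u₂ : ZMod q) := IsUnit.of_mul_eq_one _ hVQ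
  have hb : IsUnit ((u₁ : ZMod q) - 1) := by
    rw [show (u₁ : ZMod q) - 1 = -((u₁ : ZMod q) * ((p₁ : ZMod q) - 1)) by linear_combination hUP]
    exact (hU.mul ha).neg
  have hd : IsUnit ((u₂ : ZMod q) - 1) := by
    rw [show (u₂ : ZMod q) - 1 = -((u₂ : ZMod q) * ((p₂ : ZMod q) - 1)) by linear_combination hVQ]
    exact (hV.mul hc).neg
  -- the hypotheses (4.13)/(4.14) for `k = 1` and `k = K`
  have hm₁' : ¬ (q : ℤ) ∣ p₁ - 1 := not_dvd_of_unit (by push_cast; exact ha)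
  have hmK : ¬ (q : ℤ) ∣ K * (p₁ - 1) := not_dvd_of_unit (by push_cast; exact hKu.mul ha)
  have hpK : ¬ (q : ℤ) ∣ K * (p₁ + 1) := by
    intro hdvd
    apply hp₁
    have h0 := (ZMod.intCast_zmod_eq_zero_iff_dvd _ q).mpr hdvd
    push_cast at h0
    rw [hKu.mul_right_eq_zero] at h0
    exact (ZMod.intCast_zmod_eq_zero_iff_dvd _ q).mp (by push_cast; exact h0)
  have h2K : ¬ (q : ℤ) ∣ 2 * K := by
    intro hdvd
    apply h2
    have h0 := (ZMod.intCast_zmod_eq_zero_iff_dvd _ q).mpr hdvd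
    push_cast at h0
    rw [hKu.mul_left_eq_zero] at h0
    exact (ZMod.intCast_zmod_eq_zero_iff_dvd _ q).mp (by exact_mod_cast h0)
  -- (7.5), read in `ℤ/q`
  have hrel := cot_pairSum_eq_of_lensMultiplicity_eq hu₁ hu₂ h2 h2K hm₁' hp₁ hmK hpK hK₁ hK₂ h
  simp only [cot_intCast_eq_cot_val_pp (q := q)] at hrel
  have c1 : ((p₁ - 1 : ℤ) : ZMod q) = (p₁ : ZMod q) - 1 := by push_cast; ring
  have c2 : ((K * (p₁ - 1) : ℤ) : ZMod q) = (K : ZMod q) * ((p₁ : ZMod q) - 1) := by push_cast; ring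
  have c3 : ((u₁ - 1 : ℤ) : ZMod q) = (u₁ : ZMod q) - 1 := by push_cast; ring
  have c4 : ((K * (u₁ - 1) : ℤ) : ZMod q) = (K : ZMod q) * ((u₁ : ZMod q) - 1) := by push_cast; ring
  have c5 : ((p₂ - 1 : ℤ) : ZMod q) = (p₂ : ZMod q) - 1 := by push_cast; ring
  have c6 : ((K * (p₂ - 1) : ℤ) : ZMod q) = (K : ZMod q) * ((p₂ : ZMod q) - 1) := by push_cast; ring
  have c7 : ((u₂ - 1 : ℤ) : ZMod q) = (u₂ : ZMod q) - 1 := by push_cast; ring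
  have c8 : ((K * (u₂ - 1) : ℤ) : ZMod q) = (K : ZMod q) * ((u₂ : ZMod q) - 1) := by push_cast; ring
  rw [c1, c2, c3, c4, c5, c6, c7, c8] at hrel
  -- Lemma 5.3 for the eight signed unit points of (7.5)
  have hKa := hKu.mul ha
  have hKb := hKu.mul hb
  have hKc := hKu.mul hc
  have hKd := hKu.mul hd
  have hind := sum_signedIndicator_eq_zero_of_sum_mul_cot_eq_zero hq
    ![(p₁ : ZMod q) - 1, (K : ZMod q) * ((p₁ : ZMod q) - 1), (u₁ : ZMod q) - 1, (K : ZMod q) * ((u₁ : ZMod q) - 1),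
      (p₂ : ZMod q) - 1, (K : ZMod q) * ((p₂ : ZMod q) - 1), (u₂ : ZMod q) - 1, (K : ZMod q) * ((u₂ : ZMod q) - 1)]
    (by intro i; fin_cases i <;> assumption)
    ![1, 1, 1, 1, -1, -1, -1, -1]
    (by simp only [Fin.sum_univ_eight, Matrix.cons_val]; push_cast; linear_combination hrel) y
  rw [Fin.sum_univ_eight] at hind
  -- read the vector entries definitionally (keeps the `Decidable` instances those of the statement)
  have hind' : (1 : ℤ) * ((if y = (p₁ : ZMod q) - 1 then (1 : ℤ) else 0) - (if y = -((p₁ : ZMod q) - 1) then 1 else 0)) +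
      1 * ((if y = (K : ZMod q) * ((p₁ : ZMod q) - 1) then (1 : ℤ) else 0) -
        (if y = -((K : ZMod q) * ((p₁ : ZMod q) - 1)) then 1 else 0)) +
      1 * ((if y = (u₁ : ZMod q) - 1 then (1 : ℤ) else 0) - (if y = -((u₁ : ZMod q) - 1) then 1 else 0)) +
      1 * ((if y = (K : ZMod q) * ((u₁ : ZMod q) - 1) then (1 : ℤ) else 0) -
        (if y = -((K : ZMod q) * ((u₁ : ZMod q) - 1)) then 1 else 0)) +
      (-1) * ((if y = (p₂ : ZMod q) - 1 then (1 : ℤ) else 0) - (if y = -((p₂ : ZMod q) - 1) then 1 else 0)) +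
      (-1) * ((if y = (K : ZMod q) * ((p₂ : ZMod q) - 1) then (1 : ℤ) else 0) -
        (if y = -((K : ZMod q) * ((p₂ : ZMod q) - 1)) then 1 else 0)) +
      (-1) * ((if y = (u₂ : ZMod q) - 1 then (1 : ℤ) else 0) - (if y = -((u₂ : ZMod q) - 1) then 1 else 0)) +
      (-1) * ((if y = (K : ZMod q) * ((u₂ : ZMod q) - 1) then (1 : ℤ) else 0) -
        (if y = -((K : ZMod q) * ((u₂ : ZMod q) - 1)) then 1 else 0)) = 0 := hind
  linear_combination hind'

/-! ### §2 The combinatorics of §7: (7.6)–(7.28) from the signed-indicator identity -/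

/-- Non-cancellation inside one side of (7.5) ((7.6), (7.7) and their analogues, the content of (7.19) apart from (7.8)):
with `a = P − 1` a unit, `b = P* − 1 = −P*a`, `P ≢ −1`, `K` a unit with `K + 1 ≠ 0 ≠ K − 1` and `2` a unit, none of
`a = −a`, `a = ±Ka`, `Ka = −Ka`, `a = ±b`, `Ka = ±Kb` holds. [cite: IkedaYamamoto1979, §7 (7.6), (7.7), (7.19)] -/
private theorem side_ne_pp {q : ℕ} [NeZero q] (hq : 2 < q) (h2 : IsUnit (2 : ZMod q)) {P U K : ZMod q}
    (hUP : U * P = 1) (ha : IsUnit (P - 1)) (hP : P + 1 ≠ 0) (hK : IsUnit K) (hK1 : K + 1 ≠ 0) (hK1' : K - 1 ≠ 0) :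
    P - 1 ≠ -(P - 1) ∧ P - 1 ≠ K * (P - 1) ∧ P - 1 ≠ -(K * (P - 1)) ∧ K * (P - 1) ≠ -(K * (P - 1)) ∧
      P - 1 ≠ U - 1 ∧ P - 1 ≠ -(U - 1) ∧ K * (P - 1) ≠ K * (U - 1) ∧ K * (P - 1) ≠ -(K * (U - 1)) := by
  haveI : Nontrivial (ZMod q) := ZMod.nontrivial_iff.mpr (by omega)
  have kill : ∀ {t x : ZMod q}, IsUnit x → t * x = 0 → t = 0 := fun hx h ↦ (hx.mul_left_eq_zero).mp h
  have hb : U - 1 = -(U * (P - 1)) := by linear_combination hUP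
  have hU1 : U + 1 ≠ 0 := fun h0 ↦ hP (by linear_combination P * h0 - hUP)
  have hU2 : U - 1 ≠ 0 := fun h0 ↦ ha.ne_zero (by linear_combination (-P) * h0 + hUP)
  refine ⟨fun h ↦ ?_, fun h ↦ ?_, fun h ↦ ?_, fun h ↦ ?_, fun h ↦ ?_, fun h ↦ ?_, fun h ↦ ?_, fun h ↦ ?_⟩
  · exact (h2.mul ha).ne_zero (by linear_combination h)
  · exact hK1' (kill ha (by linear_combination -h))
  · exact hK1 (kill ha (by linear_combination h))
  · exact (h2.mul (hK.mul ha)).ne_zero (by linear_combination h)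
  · exact hU1 (kill ha (by linear_combination h + hb))
  · exact hU2 (kill ha (by linear_combination hb - h))
  · exact hU1 (kill hK (kill ha (by linear_combination h + K * hb)))
  · exact hU2 (kill hK (kill ha (by linear_combination K * hb - h)))

/-- **Case (7.8) of §7 is impossible** ((7.11)–(7.18)). In `ℤ/q` (`q ≥ 3`, `2` a unit) let `P, U = P*`, `Q, V = Q*`
(`UP = VQ = 1`) with `c = Q − 1` a unit and `Q ≢ −1`, let `K` be a unit with `K + 1 ≠ 0`,
`(K + 1)(K − 1) ≠ 0`, suppose the signed-indicator identity of (7.5) for the points `(a, Ka, b, Kb)` / `(c, Kc, d, Kd)`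
(`b = U − 1`, `d = V − 1`), and suppose `P ≠ Q`, `P ≠ Q*`, `Q ≠ P*` ("`p₁ ≢ p₂, p₂*`"). Then (7.8), i.e. `a ≡ −Kb`, i.e.
(7.11) `KP* = 1` (`p₁ ≡ k`), is impossible: it gives `Kb = −a`, and the identity read at `y = Kc` and at `y = Kd` forces
`Kc = b = Kd`, so `c = d`, `Q* ≡ −1`. [cite: IkedaYamamoto1979, §7 (7.8), (7.11)–(7.18)] -/
theorem false_of_signedIndicator_pair_eq_of_mul_eq_one {q : ℕ} [NeZero q] (hq : 2 < q) (h2 : IsUnit (2 : ZMod q))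
    {P U Q V K : ZMod q} (hUP : U * P = 1) (hVQ : V * Q = 1) (hc : IsUnit (Q - 1)) (hQ : Q + 1 ≠ 0)
    (hK : IsUnit K) (hK1 : K + 1 ≠ 0) (hK2 : (K + 1) * (K - 1) ≠ 0) (hPQ : P ≠ Q) (hPV : P ≠ V) (hQU : Q ≠ U)
    (hind : ∀ y : ZMod q,
        ((if y = P - 1 then (1 : ℤ) else 0) - (if y = -(P - 1) then 1 else 0)) +
          ((if y = K * (P - 1) then (1 : ℤ) else 0) - (if y = -(K * (P - 1)) then 1 else 0)) +
          ((if y = U - 1 then (1 : ℤ) else 0) - (if y = -(U - 1) then 1 else 0)) +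
          ((if y = K * (U - 1) then (1 : ℤ) else 0) - (if y = -(K * (U - 1)) then 1 else 0)) =
        ((if y = Q - 1 then (1 : ℤ) else 0) - (if y = -(Q - 1) then 1 else 0)) +
          ((if y = K * (Q - 1) then (1 : ℤ) else 0) - (if y = -(K * (Q - 1)) then 1 else 0)) +
          ((if y = V - 1 then (1 : ℤ) else 0) - (if y = -(V - 1) then 1 else 0)) +
          ((if y = K * (V - 1) then (1 : ℤ) else 0) - (if y = -(K * (V - 1)) then 1 else 0)))
    (hKU : K * U = 1) : False := by
  haveI : Nontrivial (ZMod q) := ZMod.nontrivial_iff.mpr (by omega)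
  have kill : ∀ {t x : ZMod q}, IsUnit x → t * x = 0 → t = 0 := fun hx h ↦ (hx.mul_left_eq_zero).mp h
  have hK1' : K - 1 ≠ 0 := fun h0 ↦ hK2 (by rw [h0, mul_zero])
  have hU : IsUnit U := IsUnit.of_mul_eq_one _ hUP
  have hV : IsUnit V := IsUnit.of_mul_eq_one _ hVQ
  have hb : U - 1 = -(U * (P - 1)) := by linear_combination hUP
  have hd : V - 1 = -(V * (Q - 1)) := by linear_combination hVQ
  have hdu : IsUnit (V - 1) := by rw [hd]; exact (hV.mul hc).neg
  have hV1 : V + 1 ≠ 0 := fun h0 ↦ hQ (by linear_combination Q * h0 - hVQ)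
  obtain ⟨-, c2, c3, c4, c5, -, c7, c8⟩ := side_ne_pp hq h2 hVQ hc hQ hK hK1 hK1'
  obtain ⟨-, d2, d3, d4, -, -, -, -⟩ := side_ne_pp hq h2 (by rw [mul_comm]; exact hVQ) hdu hV1 hK hK1 hK1'
  -- (7.11): `Kb = −a`
  have hKb : K * (U - 1) = -(P - 1) := by linear_combination (1 - P) * hKU + K * hUP
  -- the identity at `y = Kc`: `Kc = b`
  have e1 : K * (Q - 1) = U - 1 := by
    have hy := hind (K * (Q - 1))
    rw [hKb, neg_neg] at hy
    have k1 : K * (Q - 1) ≠ K * (P - 1) := fun h ↦ hPQ (by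
      have := kill hK (show (P - Q) * K = 0 by linear_combination -h); linear_combination this)
    have k2 : K * (Q - 1) ≠ Q - 1 := fun h ↦ c2 h.symm
    have k3 : K * (Q - 1) ≠ -(Q - 1) := fun h ↦ c3 (by linear_combination h)
    have k5 : K * (Q - 1) ≠ -(V - 1) := fun h ↦ hQU (by
      have f1 := kill hc (show (K - V) * (Q - 1) = 0 by linear_combination h - hd)
      have f2 := kill hV (show (U - Q) * V = 0 by linear_combination (-U) * f1 + hKU - hVQ)
      linear_combination -f2)
    rw [if_neg k1, if_neg k2, if_neg k3, if_neg c4, if_neg k5, if_neg c7, if_neg c8, if_pos rfl] at hy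
    by_contra hne
    rw [if_neg hne] at hy
    split_ifs at hy <;> omega
  -- the identity at `y = Kd`: `Kd = b`
  have e2 : K * (V - 1) = U - 1 := by
    have hy := hind (K * (V - 1))
    rw [hKb, neg_neg] at hy
    have m1 : K * (V - 1) ≠ K * (P - 1) := fun h ↦ hPV (by
      have := kill hK (show (P - V) * K = 0 by linear_combination -h); linear_combination this)
    have m2 : K * (V - 1) ≠ -(Q - 1) := fun h ↦ hPQ (by
      have f1 := kill hc (show (K * V - 1) * (Q - 1) = 0 by linear_combination K * hd - h)
      have f2 := kill hK (show (V - U) * K = 0 by linear_combination f1 - hKU)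
      have f3 := kill hU (show (Q - P) * U = 0 by linear_combination (-Q) * f2 + hVQ - hUP)
      linear_combination -f3)
    have m3 : K * (V - 1) ≠ K * (Q - 1) := fun h ↦ c7 h.symm
    have m4 : K * (V - 1) ≠ -(K * (Q - 1)) := fun h ↦ c8 (by linear_combination h)
    have m5 : K * (V - 1) ≠ V - 1 := fun h ↦ d2 h.symm
    have m6 : K * (V - 1) ≠ -(V - 1) := fun h ↦ d3 (by linear_combination h)
    rw [if_neg m1, if_neg m2, if_neg m3, if_neg m4, if_neg m5, if_neg m6, if_neg d4, if_pos rfl] at hy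
    by_contra hne
    rw [if_neg hne] at hy
    split_ifs at hy <;> omega
  -- `Kc = Kd`, `c = d`: impossible
  exact c5 (by have := kill hK (show ((Q - 1) - (V - 1)) * K = 0 by linear_combination e1 - e2); linear_combination this)

/-- **Cases (7.9), (7.10) of §7 are impossible under (7.19)** ((7.20)–(7.28)). In the setting of
`false_of_signedIndicator_pair_eq_of_mul_eq_one`, suppose moreover (7.19): no two terms of one side of (7.5) cancel, i.e.
`KP* ≠ 1`, `P* ≠ K`, `KQ* ≠ 1`, `Q* ≠ K`. Then the signed-indicator identity is contradictory: read at `y = a` it leaves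
only (7.9) `a = Kc` or (7.10) `a = Kd`; read at `y = Ka`, `c`, `Kc` it gives the companions (7.20)/(7.21), and these
force `K² = 1` — impossible, (7.22) `(k + 1)(k − 1) ≢ 0` — or `P*Q* = 1`, i.e. `p₁ ≡ p₂*` (7.28).
[cite: IkedaYamamoto1979, §7 (7.9), (7.10), (7.19)–(7.28)] -/
theorem false_of_signedIndicator_pair_eq {q : ℕ} [NeZero q] (hq : 2 < q) (h2 : IsUnit (2 : ZMod q))
    {P U Q V K : ZMod q} (hUP : U * P = 1) (hVQ : V * Q = 1) (ha : IsUnit (P - 1)) (hc : IsUnit (Q - 1))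
    (hP : P + 1 ≠ 0) (hQ : Q + 1 ≠ 0) (hK : IsUnit K) (hK1 : K + 1 ≠ 0) (hK2 : (K + 1) * (K - 1) ≠ 0)
    (hPQ : P ≠ Q) (hPV : P ≠ V) (hQU : Q ≠ U) (hKU : K * U ≠ 1) (hUK : U ≠ K) (hKV : K * V ≠ 1) (hVK : V ≠ K)
    (hind : ∀ y : ZMod q,
        ((if y = P - 1 then (1 : ℤ) else 0) - (if y = -(P - 1) then 1 else 0)) +
          ((if y = K * (P - 1) then (1 : ℤ) else 0) - (if y = -(K * (P - 1)) then 1 else 0)) +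
          ((if y = U - 1 then (1 : ℤ) else 0) - (if y = -(U - 1) then 1 else 0)) +
          ((if y = K * (U - 1) then (1 : ℤ) else 0) - (if y = -(K * (U - 1)) then 1 else 0)) =
        ((if y = Q - 1 then (1 : ℤ) else 0) - (if y = -(Q - 1) then 1 else 0)) +
          ((if y = K * (Q - 1) then (1 : ℤ) else 0) - (if y = -(K * (Q - 1)) then 1 else 0)) +
          ((if y = V - 1 then (1 : ℤ) else 0) - (if y = -(V - 1) then 1 else 0)) +
          ((if y = K * (V - 1) then (1 : ℤ) else 0) - (if y = -(K * (V - 1)) then 1 else 0))) :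
    False := by
  haveI : Nontrivial (ZMod q) := ZMod.nontrivial_iff.mpr (by omega)
  have kill : ∀ {t x : ZMod q}, IsUnit x → t * x = 0 → t = 0 := fun hx h ↦ (hx.mul_left_eq_zero).mp h
  have hK1' : K - 1 ≠ 0 := fun h0 ↦ hK2 (by rw [h0, mul_zero])
  have hU : IsUnit U := IsUnit.of_mul_eq_one _ hUP
  have hV : IsUnit V := IsUnit.of_mul_eq_one _ hVQ
  have hb : U - 1 = -(U * (P - 1)) := by linear_combination hUP
  have hd : V - 1 = -(V * (Q - 1)) := by linear_combination hVQ
  obtain ⟨a1, a2, a3, a4, a5, a6, a7, a8⟩ := side_ne_pp hq h2 hUP ha hP hK hK1 hK1'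
  obtain ⟨c1, c2, c3, c4, c5, c6, c7, c8⟩ := side_ne_pp hq h2 hVQ hc hQ hK hK1 hK1'
  -- cross facts
  have g1 : P - 1 ≠ -(K * (U - 1)) := fun h ↦ hKU (by
    have := kill ha (show (K * U - 1) * (P - 1) = 0 by linear_combination K * hb - h); linear_combination this)
  have g2 : P - 1 ≠ Q - 1 := fun h ↦ hPQ (by linear_combination h)
  have g3 : P - 1 ≠ V - 1 := fun h ↦ hPV (by linear_combination h)
  have g4 : K * (P - 1) ≠ -(U - 1) := fun h ↦ hUK (by
    have := kill ha (show (K - U) * (P - 1) = 0 by linear_combination h - hb); linear_combination -this)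
  have g5 : K * (P - 1) ≠ K * (Q - 1) := fun h ↦ hPQ (by
    have := kill hK (show (P - Q) * K = 0 by linear_combination h); linear_combination this)
  have g6 : K * (P - 1) ≠ K * (V - 1) := fun h ↦ hPV (by
    have := kill hK (show (P - V) * K = 0 by linear_combination h); linear_combination this)
  have g7 : Q - 1 ≠ -(K * (V - 1)) := fun h ↦ hKV (by
    have := kill hc (show (K * V - 1) * (Q - 1) = 0 by linear_combination K * hd - h); linear_combination this)
  have g8 : Q - 1 ≠ U - 1 := fun h ↦ hQU (by linear_combination h)
  have g9 : K * (Q - 1) ≠ -(V - 1) := fun h ↦ hVK (by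
    have := kill hc (show (K - V) * (Q - 1) = 0 by linear_combination h - hd); linear_combination -this)
  have g10 : K * (Q - 1) ≠ K * (U - 1) := fun h ↦ hQU (by
    have := kill hK (show (Q - U) * K = 0 by linear_combination h); linear_combination this)
  -- the identity at `y = a`: (7.9) `a = Kc` or (7.10) `a = Kd`
  have hA : P - 1 = K * (Q - 1) ∨ P - 1 = K * (V - 1) := by
    have hy := hind (P - 1)
    rw [if_pos rfl, if_neg a1, if_neg a2, if_neg a3, if_neg a5, if_neg a6, if_neg g1, if_neg g2, if_neg g3] at hy
    by_contra hne
    rw [not_or] at hne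
    rw [if_neg hne.1, if_neg hne.2] at hy
    split_ifs at hy <;> omega
  -- at `y = Ka`: (7.20) `Ka = c` or (7.21) `Ka = d`
  have hB : K * (P - 1) = Q - 1 ∨ K * (P - 1) = V - 1 := by
    have hy := hind (K * (P - 1))
    have b1 : K * (P - 1) ≠ P - 1 := fun h ↦ a2 h.symm
    have b2 : K * (P - 1) ≠ -(P - 1) := fun h ↦ a3 (by linear_combination h)
    rw [if_pos rfl, if_neg b1, if_neg b2, if_neg a4, if_neg g4, if_neg a7, if_neg a8, if_neg g5, if_neg g6] at hy
    by_contra hne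
    rw [not_or] at hne
    rw [if_neg hne.1, if_neg hne.2] at hy
    split_ifs at hy <;> omega
  -- at `y = c`: `c = Ka` or `c = Kb`
  have hC : Q - 1 = K * (P - 1) ∨ Q - 1 = K * (U - 1) := by
    have hy := hind (Q - 1)
    have d1 : Q - 1 ≠ P - 1 := fun h ↦ g2 h.symm
    rw [if_pos rfl, if_neg c1, if_neg c2, if_neg c3, if_neg c5, if_neg c6, if_neg g7, if_neg d1, if_neg g8] at hy
    by_contra hne
    rw [not_or] at hne
    rw [if_neg hne.1, if_neg hne.2] at hy
    split_ifs at hy <;> omega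
  -- at `y = Kc`: (7.23)-type companions `Kc = a` or `Kc = b`
  have hD : K * (Q - 1) = P - 1 ∨ K * (Q - 1) = U - 1 := by
    have hy := hind (K * (Q - 1))
    have d1 : K * (Q - 1) ≠ Q - 1 := fun h ↦ c2 h.symm
    have d2 : K * (Q - 1) ≠ -(Q - 1) := fun h ↦ c3 (by linear_combination h)
    have d3 : K * (Q - 1) ≠ K * (P - 1) := fun h ↦ g5 h.symm
    rw [if_pos rfl, if_neg d1, if_neg d2, if_neg c4, if_neg g9, if_neg c7, if_neg c8, if_neg d3, if_neg g10] at hy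
    by_contra hne
    rw [not_or] at hne
    rw [if_neg hne.1, if_neg hne.2] at hy
    split_ifs at hy <;> omega
  -- the algebra (7.22)–(7.28)
  rcases hA with e1 | e1
  · -- (7.9) `a = Kc`
    rcases hB with e2 | e2
    · -- (7.20): `K²c = c`, `K² = 1`: (7.22)
      have f := kill hc (show (K * K - 1) * (Q - 1) = 0 by linear_combination e2 - K * e1)
      exact hK2 (by linear_combination f)
    · -- (7.21): `K²c = d = −Vc`, `V = −K²` (7.26)
      have f1 := kill hc (show (K * K + V) * (Q - 1) = 0 by linear_combination e2 - K * e1 + hVQ)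
      rcases hC with e3 | e3
      · have f := kill hc (show (K * K - 1) * (Q - 1) = 0 by linear_combination -e3 - K * e1)
        exact hK2 (by linear_combination f)
      · -- (7.23): `c = Kb = −KUa = −K²Uc`, `K²U = −1` (7.27); then `UV = 1`, `P = V` (7.28)
        have f2 := kill hc (show (1 + K * K * U) * (Q - 1) = 0 by linear_combination e3 + K * hb - K * U * e1)
        exact hPV (by linear_combination (-(P * U)) * f1 + P * f2 + V * hUP)
  · -- (7.10) `a = Kd` ("in the same way")
    rcases hD with e4 | e4
    · -- `Kc = a = Kd`, `c = d`
      exact c5 (by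
        have := kill hK (show ((Q - 1) - (V - 1)) * K = 0 by linear_combination e4 + e1); linear_combination this)
    · -- `Kc = b = −Ua = −UKd = UKVc`, `UV = 1`, `P = V`
      have f3 := kill hc (show (K - K * U * V) * (Q - 1) = 0 by
        linear_combination e4 + hb - U * e1 - U * K * hd)
      have f5 := kill hK (show (1 - U * V) * K = 0 by linear_combination f3)
      exact hPV (by linear_combination P * f5 + V * hUP)

/-- **§7, second case — the combinatorial conclusion.** In `ℤ/q` (`q ≥ 3`, `2` a unit) let `P, U, Q, V, K` with
`UP = VQ = 1`, `P − 1`, `Q − 1`, `K` units, `P, Q ≢ −1`, `K + 1 ≠ 0`, `(K + 1)(K − 1) ≠ 0`, and suppose the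
signed-indicator identity of (7.5) ("applying Lemma 5.3 to (7.5)"): for every `y`,
`∑_{s ∈ (P−1, K(P−1), U−1, K(U−1))} ([y = s] − [y = −s]) = ∑_{s ∈ (Q−1, K(Q−1), V−1, K(V−1))} ([y = s] − [y = −s])`.
Then `Q = P` or `Q = U` (`p₂ ≡ p₁` or `p₂ ≡ p₁* (mod q)`): assuming the contrary, (7.8) and its three symmetric forms are
excluded by `false_of_signedIndicator_pair_eq_of_mul_eq_one` (the identity is symmetric under `P ↔ P*` and under the
exchange of the two sides), which is (7.19), and then `false_of_signedIndicator_pair_eq` applies.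
[cite: IkedaYamamoto1979, §7 (7.5)–(7.28)] -/
theorem eq_or_eq_of_signedIndicator_pair_eq {q : ℕ} [NeZero q] (hq : 2 < q) (h2 : IsUnit (2 : ZMod q))
    {P U Q V K : ZMod q} (hUP : U * P = 1) (hVQ : V * Q = 1) (ha : IsUnit (P - 1)) (hc : IsUnit (Q - 1))
    (hP : P + 1 ≠ 0) (hQ : Q + 1 ≠ 0) (hK : IsUnit K) (hK1 : K + 1 ≠ 0) (hK2 : (K + 1) * (K - 1) ≠ 0)
    (hind : ∀ y : ZMod q,
        ((if y = P - 1 then (1 : ℤ) else 0) - (if y = -(P - 1) then 1 else 0)) +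
          ((if y = K * (P - 1) then (1 : ℤ) else 0) - (if y = -(K * (P - 1)) then 1 else 0)) +
          ((if y = U - 1 then (1 : ℤ) else 0) - (if y = -(U - 1) then 1 else 0)) +
          ((if y = K * (U - 1) then (1 : ℤ) else 0) - (if y = -(K * (U - 1)) then 1 else 0)) =
        ((if y = Q - 1 then (1 : ℤ) else 0) - (if y = -(Q - 1) then 1 else 0)) +
          ((if y = K * (Q - 1) then (1 : ℤ) else 0) - (if y = -(K * (Q - 1)) then 1 else 0)) +
          ((if y = V - 1 then (1 : ℤ) else 0) - (if y = -(V - 1) then 1 else 0)) +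
          ((if y = K * (V - 1) then (1 : ℤ) else 0) - (if y = -(K * (V - 1)) then 1 else 0))) :
    Q = P ∨ Q = U := by
  haveI : Nontrivial (ZMod q) := ZMod.nontrivial_iff.mpr (by omega)
  have kill : ∀ {t x : ZMod q}, IsUnit x → t * x = 0 → t = 0 := fun hx h ↦ (hx.mul_left_eq_zero).mp h
  by_contra hne
  rw [not_or] at hne
  have hQP : Q ≠ P := hne.1
  have hQU : Q ≠ U := hne.2
  have hPQ : P ≠ Q := hQP.symm
  have hU : IsUnit U := IsUnit.of_mul_eq_one _ hUP
  have hV : IsUnit V := IsUnit.of_mul_eq_one _ hVQ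
  have hPV : P ≠ V := fun h ↦ hQU (by
    have := kill hV (show (Q - U) * V = 0 by linear_combination hVQ - hUP + U * h); linear_combination this)
  have hUV : U ≠ V := fun h ↦ hPQ (by
    have := kill hU (show (P - Q) * U = 0 by linear_combination hUP - hVQ - Q * h); linear_combination this)
  -- (7.19): the four cancelling configurations `KP* = 1`, `KP = 1`, `KQ* = 1`, `KQ = 1` are impossible
  have n1 : K * U ≠ 1 := fun e ↦
    false_of_signedIndicator_pair_eq_of_mul_eq_one hq h2 hUP hVQ hc hQ hK hK1 hK2 hPQ hPV hQU hind e
  have n2 : K * P ≠ 1 := fun e ↦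
    false_of_signedIndicator_pair_eq_of_mul_eq_one hq h2 (P := U) (U := P) (Q := Q) (V := V)
      (by rw [mul_comm]; exact hUP) hVQ hc hQ hK hK1 hK2 (Ne.symm hQU) hUV hQP
      (fun y ↦ by have := hind y; linarith) e
  have n3 : K * V ≠ 1 := fun e ↦
    false_of_signedIndicator_pair_eq_of_mul_eq_one hq h2 (P := Q) (U := V) (Q := P) (V := U) hVQ hUP ha hP
      hK hK1 hK2 hQP hQU hPV (fun y ↦ (hind y).symm) e
  have n4 : K * Q ≠ 1 := fun e ↦
    false_of_signedIndicator_pair_eq_of_mul_eq_one hq h2 (P := V) (U := Q) (Q := P) (V := U)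
      (by rw [mul_comm]; exact hVQ) hUP ha hP hK hK1 hK2 hPV.symm hUV.symm hPQ
      (fun y ↦ by have := hind y; linarith) e
  have hUK : U ≠ K := fun h ↦ n2 (by rw [← h]; exact hUP)
  have hVK : V ≠ K := fun h ↦ n4 (by rw [← h]; exact hVQ)
  exact false_of_signedIndicator_pair_eq hq h2 hUP hVQ ha hc hP hQ hK hK1 hK2 hPQ hPV hQU n1 hUK n3 hVK hind

/-! ### §3 THE MAIN THEOREM for `q = l^ν`: isospectral three-dimensional lens spaces are isometric -/

/-- `pp* ≡ 1 (mod q)` read in `ℤ/q`. [folklore] -/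
private theorem cast_mul_cast_eq_one_pp {q : ℕ} {p u : ℤ} (hu : (q : ℤ) ∣ u * p - 1) :
    (u : ZMod q) * (p : ZMod q) = 1 := by
  have h := (ZMod.intCast_zmod_eq_zero_iff_dvd (u * p - 1) q).mpr hu
  push_cast at h
  exact sub_eq_zero.mp h

/-- An odd prime `l` divides at most one of `t + 1`, `t − 1`. [folklore] -/
private theorem not_dvd_sub_one_of_dvd_add_one_pp {l : ℕ} (hl : l.Prime) (hl2 : l ≠ 2) {t : ℤ} (h : (l : ℤ) ∣ t + 1) :
    ¬ (l : ℤ) ∣ t - 1 := by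
  intro h'
  have h2 : (l : ℤ) ∣ 2 := by have := dvd_sub h h'; rwa [show t + 1 - (t - 1) = 2 by ring] at this
  have h2' : l ∣ 2 := by exact_mod_cast h2
  exact hl2 ((Nat.le_of_dvd two_pos h2').antisymm hl.two_le)

/-- **§7, second case — THE MAIN THEOREM (Ikeda–Yamamoto 1979), normalized weights, when `l ∣ pᵢ + 1`.** Let `q` be odd
and `l` an odd prime with `l² ∣ q`; let `p₁, p₂` be prime to `q` with `p₁ − 1`, `p₂ − 1` prime to `q`, `l ∣ p₁ + 1`,
`l ∣ p₂ + 1` and `q ∤ p₁ + 1` (for `q = l^ν`: the normalization (7.1) `(p₁ + 1, q) = (p₂ + 1, q) = l^μ`, `1 ≤ μ < ν`,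
which forces `(pᵢ − 1, q) = 1`). If `L(q; 1, p₁)` and `L(q; 1, p₂)` are isospectral then `p₁ ≡ p₂` or `p₁p₂ ≡ 1 (mod q)`
("`p₁ ≡ ±p₂` or `±p₂*`", the signs `−` being excluded by `pᵢ ≡ −1 (mod l)`): (7.5) with `K = q/l − 1`, Lemma 5.3, and the
combinatorics (7.6)–(7.28) (`eq_or_eq_of_signedIndicator_pair_eq`; `K` is a unit as `l ∣ q/l`, `K + 1 = q/l ≢ 0`, and
`(K + 1)(K − 1) = (q/l)(q/l − 2) ≢ 0` as `l ∤ q/l − 2`). [cite: IkedaYamamoto1979, Main Theorem, §7 (7.1)–(7.28),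
Proposition 4.1] -/
theorem dvd_of_lensMultiplicity_one_eq_of_dvd_add_one {q l : ℕ} [NeZero q] (hqo : Odd q) (hl : l.Prime) (hl2 : l ≠ 2)
    (hll : l * l ∣ q) {p₁ p₂ : ℤ} (hp₁ : IsCoprime p₁ q) (hp₂ : IsCoprime p₂ q) (hm₁ : IsCoprime (p₁ - 1) q)
    (hm₂ : IsCoprime (p₂ - 1) q) (hl₁ : (l : ℤ) ∣ p₁ + 1) (hl₂ : (l : ℤ) ∣ p₂ + 1) (hq₁ : ¬ (q : ℤ) ∣ p₁ + 1)
    (h : ∀ n : ℕ, lensMultiplicity q 1 p₁ n = lensMultiplicity q 1 p₂ n) :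
    (q : ℤ) ∣ p₁ - p₂ ∨ (q : ℤ) ∣ p₁ * p₂ - 1 := by
  -- `q = ml`, `l ∣ m`, `K = m − 1`
  have hlq : l ∣ q := (dvd_mul_right l l).trans hll
  set m : ℕ := q / l with hm
  have hqm : q = m * l := (Nat.div_mul_cancel hlq).symm
  have hlm : l ∣ m := (Nat.dvd_div_iff_mul_dvd hlq).mpr hll
  have hl3 : 3 ≤ l := by
    have := hl.two_le
    omega
  have hq0 : 0 < q := Nat.pos_of_ne_zero (NeZero.ne q)
  have hmq : m < q := Nat.div_lt_self hq0 (by omega)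
  have hm0 : m ≠ 0 := by
    intro h0
    rw [h0, zero_mul] at hqm
    exact NeZero.ne q hqm
  have hq3 : 2 < q := by
    have : l * l ≤ q := Nat.le_of_dvd hq0 hll
    nlinarith
  haveI : Nontrivial (ZMod q) := ZMod.nontrivial_iff.mpr (by omega)
  -- the data of (7.5)
  obtain ⟨u₁, b₁, hub₁⟩ := hp₁
  obtain ⟨u₂, b₂, hub₂⟩ := hp₂
  have hu₁ : (q : ℤ) ∣ u₁ * p₁ - 1 := ⟨-b₁, by linear_combination hub₁⟩
  have hu₂ : (q : ℤ) ∣ u₂ * p₂ - 1 := ⟨-b₂, by linear_combination hub₂⟩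
  have h2 : ¬ (q : ℤ) ∣ 2 := by
    intro hd
    have := Int.le_of_dvd two_pos hd
    have : (2 : ℤ) < q := by exact_mod_cast hq3
    omega
  have hqmz : (q : ℤ) = (m : ℤ) * (l : ℤ) := by exact_mod_cast hqm
  have hK : IsCoprime ((m : ℤ) - 1) q := by
    have hKm : IsCoprime ((m : ℤ) - 1) (m : ℤ) := ⟨-1, 1, by ring⟩
    have hKl : IsCoprime ((m : ℤ) - 1) (l : ℤ) := by
      obtain ⟨t, ht⟩ := hlm
      exact ⟨-1, (t : ℤ), by rw [ht]; push_cast; ring⟩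
    rw [hqmz]
    exact hKm.mul_right hKl
  have hK₁ : (q : ℤ) ∣ ((m : ℤ) - 1 + 1) * (p₁ + 1) := by
    rw [sub_add_cancel, hqmz]
    exact mul_dvd_mul_left _ hl₁
  have hK₂ : (q : ℤ) ∣ ((m : ℤ) - 1 + 1) * (p₂ + 1) := by
    rw [sub_add_cancel, hqmz]
    exact mul_dvd_mul_left _ hl₂
  -- Lemma 5.3 applied to (7.5)
  have hind := signedIndicator_pair_eq_of_lensMultiplicity_eq hq3 hu₁ hu₂ h2 hm₁ hm₂ hq₁ hK hK₁ hK₂ h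
  -- the hypotheses of the combinatorial core, in `ℤ/q`
  have hUP := cast_mul_cast_eq_one_pp hu₁
  have hVQ := cast_mul_cast_eq_one_pp hu₂
  have unit_of : ∀ {t : ℤ}, IsCoprime t q → IsUnit (t : ZMod q) := fun ht ↦
    (ZMod.coe_int_isUnit_iff_isCoprime _ _).mpr ht.symm
  have ha : IsUnit ((p₁ : ZMod q) - 1) := by have := unit_of hm₁; push_cast at this; exact this
  have hc : IsUnit ((p₂ : ZMod q) - 1) := by have := unit_of hm₂; push_cast at this; exact this
  have hKu : IsUnit (((m : ℤ) - 1 : ℤ) : ZMod q) := unit_of hK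
  have h2u : IsUnit (2 : ZMod q) := by
    have := (ZMod.isUnit_iff_coprime 2 q).mpr (Nat.coprime_two_left.mpr hqo)
    exact_mod_cast this
  have hP : (p₁ : ZMod q) + 1 ≠ 0 := fun h0 ↦ hq₁ ((ZMod.intCast_zmod_eq_zero_iff_dvd _ _).mp (by push_cast; exact h0))
  -- Corollary 4.5 at `k = 1`: `q ∤ p₂ + 1`
  have hq₂ : ¬ (q : ℤ) ∣ p₂ + 1 := by
    have hm₁' : ¬ (q : ℤ) ∣ 1 * (p₁ - 1) := by
      rw [one_mul]
      exact fun hd ↦ ha.ne_zero (by have := (ZMod.intCast_zmod_eq_zero_iff_dvd _ _).mpr hd; push_cast at this; exact this)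
    have := (not_dvd_of_lensMultiplicity_eq (k := 1) hu₁ hu₂ (by rwa [mul_one]) (by rwa [one_mul]) hm₁' h).1
    rwa [one_mul] at this
  have hQ : (p₂ : ZMod q) + 1 ≠ 0 := fun h0 ↦ hq₂ ((ZMod.intCast_zmod_eq_zero_iff_dvd _ _).mp (by push_cast; exact h0))
  -- `K + 1 = m ≢ 0` and `(K + 1)(K − 1) = m(m − 2) ≢ 0 (mod q)`
  have hK1 : (((m : ℤ) - 1 : ℤ) : ZMod q) + 1 ≠ 0 := by
    intro h0
    have hd : (q : ℤ) ∣ (m : ℤ) := (ZMod.intCast_zmod_eq_zero_iff_dvd _ _).mp (by push_cast at h0 ⊢; linear_combination h0)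
    have := Int.le_of_dvd (by exact_mod_cast Nat.pos_of_ne_zero hm0) hd
    have : (m : ℤ) < q := by exact_mod_cast hmq
    omega
  have hK2 : ((((m : ℤ) - 1 : ℤ) : ZMod q) + 1) * ((((m : ℤ) - 1 : ℤ) : ZMod q) - 1) ≠ 0 := by
    intro h0
    have hd : (q : ℤ) ∣ (m : ℤ) * ((m : ℤ) - 2) :=
      (ZMod.intCast_zmod_eq_zero_iff_dvd _ _).mp (by push_cast at h0 ⊢; linear_combination h0)
    rw [hqmz] at hd
    have hm0' : (m : ℤ) ≠ 0 := by exact_mod_cast hm0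
    have hd' : (l : ℤ) ∣ (m : ℤ) - 2 := (mul_dvd_mul_iff_left hm0').mp hd
    have hlm' : (l : ℤ) ∣ (m : ℤ) := by exact_mod_cast hlm
    have hl2' : (l : ℤ) ∣ 2 := by have := dvd_sub hlm' hd'; rwa [show (m : ℤ) - ((m : ℤ) - 2) = 2 by ring] at this
    have : l ∣ 2 := by exact_mod_cast hl2'
    exact hl2 ((Nat.le_of_dvd two_pos this).antisymm hl.two_le)
  have key := eq_or_eq_of_signedIndicator_pair_eq hq3 h2u hUP hVQ ha hc hP hQ hKu hK1 hK2 hind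
  rcases key with e | e
  · refine Or.inl ((ZMod.intCast_zmod_eq_zero_iff_dvd _ _).mp ?_)
    push_cast; rw [e]; ring
  · refine Or.inr ((ZMod.intCast_zmod_eq_zero_iff_dvd _ _).mp ?_)
    push_cast; rw [e]; linear_combination hUP

/-- **THE MAIN THEOREM (Ikeda–Yamamoto 1979) for `q = l^ν`, `l` an odd prime, `ν ≥ 1`, normalized weights.** Let `p₁, p₂`
be prime to `q = l^ν`. If the three-dimensional lens spaces `L(q; 1, p₁)` and `L(q; 1, p₂)` are isospectral (`dim E_{n(n+2)}`
agree for all `n`) then `p₁ ≡ ±p₂` or `p₁p₂ ≡ ±1 (mod q)` — (4.1)/(4.2) of Proposition 4.1: the two lens spaces are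
isometric. Cases: `ν = 1` is §6 (row g45-#2); the homogeneous case `p₁ ≡ ±1` is Corollary 3.4 of the tree; `(p₁ ± 1, q) = 1`
is the first case of §7 (row g45-#5); otherwise `l ∣ p₁ + 1` or `l ∣ p₁ − 1`, and — replacing `p₁`, `p₂` by `±p₁`, `±p₂`
(isometric spaces, same multiplicities) and using Lemma 4.4 (`l ∣ p₂ + 1` or `l ∣ p₂ − 1`) — we are in the second case
`l ∣ pᵢ + 1` (`dvd_of_lensMultiplicity_one_eq_of_dvd_add_one`). [cite: IkedaYamamoto1979, Main Theorem (`q = l^ν`), §6, §7,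
Lemma 4.4, Corollary 3.4, Proposition 4.1] -/
theorem dvd_of_lensMultiplicity_one_eq_of_prime_pow {q l ν : ℕ} (hq : q = l ^ ν) (hl : l.Prime) (hl2 : l ≠ 2) (hν : ν ≠ 0)
    {p₁ p₂ : ℤ} (hp₁ : IsCoprime p₁ q) (hp₂ : IsCoprime p₂ q)
    (h : ∀ n : ℕ, lensMultiplicity q 1 p₁ n = lensMultiplicity q 1 p₂ n) :
    (q : ℤ) ∣ p₁ - p₂ ∨ (q : ℤ) ∣ p₁ + p₂ ∨ (q : ℤ) ∣ p₁ * p₂ - 1 ∨ (q : ℤ) ∣ p₁ * p₂ + 1 := by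
  have hl3 : 3 ≤ l := by have := hl.two_le; omega
  have hq0 : q ≠ 0 := by rw [hq]; exact pow_ne_zero _ hl.ne_zero
  haveI : NeZero q := ⟨hq0⟩
  have hqo : Odd q := by rw [hq]; exact (hl.odd_of_ne_two hl2).pow
  have hq3 : 3 ≤ q := by rw [hq]; exact hl3.trans (Nat.le_self_pow hν l)
  -- `ν = 1`: `q` prime, §6
  by_cases hν1 : ν = 1
  · subst hν1
    rw [pow_one] at hq
    subst hq
    haveI : Fact q.Prime := ⟨hl⟩
    exact dvd_of_lensMultiplicity_one_eq_of_prime hl2 hp₁ hp₂ h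
  -- `ν ≥ 2`: `l² ∣ q`
  have hll : l * l ∣ q := by
    rw [hq, ← sq]
    exact pow_dvd_pow l (by omega)
  have hlq : (l : ℤ) ∣ (q : ℤ) := by exact_mod_cast (dvd_mul_right l l).trans hll
  have hlP : Prime (l : ℤ) := Nat.prime_iff_prime_int.mp hl
  -- in `q = l^ν` a number not divisible by `l` is prime to `q`
  have honly : ∀ {t : ℤ}, ¬ (l : ℤ) ∣ t → IsCoprime t q := by
    intro t ht
    have h1 : IsCoprime t (l : ℤ) := ((Prime.coprime_iff_not_dvd hlP).mpr ht).symm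
    have := h1.pow_right (n := ν)
    rw [hq]; push_cast; exact this
  have hl2' : ¬ (l : ℤ) ∣ 2 := by
    intro hd
    have : l ∣ 2 := by exact_mod_cast hd
    exact hl2 ((Nat.le_of_dvd two_pos this).antisymm hl.two_le)
  have h1cop : IsCoprime (1 : ℤ) q := isCoprime_one_left
  -- the homogeneous case: COROLLARY 3.4
  have hom : ∀ {a b : ℤ}, IsCoprime b q → (∀ n : ℕ, lensMultiplicity q 1 a n = lensMultiplicity q 1 b n) →
      ((q : ℤ) ∣ a - 1 ∨ (q : ℤ) ∣ a + 1) → (q : ℤ) ∣ a - b ∨ (q : ℤ) ∣ a + b := by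
    intro a b hb hab hhom
    have hhom' : (q : ℤ) ∣ 1 - a ∨ (q : ℤ) ∣ 1 + a := by
      rcases hhom with hh | hh
      · exact Or.inl (by rw [← dvd_neg, neg_sub]; exact hh)
      · exact Or.inr (by rwa [add_comm])
    rcases dvd_sub_or_dvd_add_of_lensMultiplicity_eq q h1cop h1cop hb hhom' hab with hb' | hb'
    · rcases hhom with hh | hh
      · left; have := dvd_add hh hb'; rwa [show a - 1 + (1 - b) = a - b by ring] at this
      · right; have := dvd_sub hh hb'; rwa [show a + 1 - (1 - b) = a + b by ring] at this
    · rcases hhom with hh | hh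
      · right; have := dvd_add hh hb'; rwa [show a - 1 + (1 + b) = a + b by ring] at this
      · left; have := dvd_sub hh hb'; rwa [show a + 1 - (1 + b) = a - b by ring] at this
  -- the second case of §7 for a pair `(a, b)` with `l ∣ a + 1`: `a ≡ ±b` or `ab ≡ ±1`
  have second : ∀ {a b : ℤ}, IsCoprime a q → IsCoprime b q → (l : ℤ) ∣ a + 1 →
      (∀ n : ℕ, lensMultiplicity q 1 a n = lensMultiplicity q 1 b n) →
      (q : ℤ) ∣ a - b ∨ (q : ℤ) ∣ a + b ∨ (q : ℤ) ∣ a * b - 1 ∨ (q : ℤ) ∣ a * b + 1 := by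
    intro a b ha hb hla hab
    by_cases hqa : (q : ℤ) ∣ a + 1
    · rcases hom hb hab (Or.inr hqa) with h' | h'
      · exact Or.inl h'
      · exact Or.inr (Or.inl h')
    have hma : IsCoprime (a - 1) q := honly (not_dvd_sub_one_of_dvd_add_one_pp hl hl2 hla)
    obtain ⟨ua, ba, huba⟩ := ha
    obtain ⟨ub, bb, hubb⟩ := hb
    have hua : (q : ℤ) ∣ ua * a - 1 := ⟨-ba, by linear_combination huba⟩
    have hub : (q : ℤ) ∣ ub * b - 1 := ⟨-bb, by linear_combination hubb⟩
    have ha' : IsCoprime a q := ⟨ua, ba, huba⟩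
    have hb' : IsCoprime b q := ⟨ub, bb, hubb⟩
    -- Lemma 4.4: `l ∣ b + 1` or `l ∣ b − 1`; in the second case pass to `−b`
    have h44 := dvd_or_dvd_of_dvd_of_lensMultiplicity_eq hua hub hab hlq hl2' (Or.inl hla)
    have core : ∀ {c : ℤ}, IsCoprime c q → (l : ℤ) ∣ c + 1 → (∀ n : ℕ, lensMultiplicity q 1 a n = lensMultiplicity q 1 c n) →
        (q : ℤ) ∣ a - c ∨ (q : ℤ) ∣ a * c - 1 := fun hc hlc hac ↦
      dvd_of_lensMultiplicity_one_eq_of_dvd_add_one hqo hl hl2 hll ha' hc hma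
        (honly (not_dvd_sub_one_of_dvd_add_one_pp hl hl2 hlc)) hla hlc hqa hac
    rcases h44 with hlb | hlb
    · rcases core hb' hlb hab with h' | h'
      · exact Or.inl h'
      · exact Or.inr (Or.inr (Or.inl h'))
    · have hlb' : (l : ℤ) ∣ -b + 1 := by rw [show -b + 1 = -(b - 1) by ring, dvd_neg]; exact hlb
      have hab' : ∀ n : ℕ, lensMultiplicity q 1 a n = lensMultiplicity q 1 (-b) n := fun n ↦ by
        rw [lensMultiplicity_neg_right, hab n]
      rcases core hb'.neg_left hlb' hab' with h' | h'
      · exact Or.inr (Or.inl (by rw [show a + b = a - -b by ring]; exact h'))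
      · exact Or.inr (Or.inr (Or.inr (by rw [show a * b + 1 = -(a * -b - 1) by ring, dvd_neg]; exact h')))
  -- dispatch on `p₁ mod l`
  by_cases hA : (l : ℤ) ∣ p₁ + 1
  · exact second hp₁ hp₂ hA h
  by_cases hB : (l : ℤ) ∣ p₁ - 1
  · -- pass to `−p₁`
    have hB' : (l : ℤ) ∣ -p₁ + 1 := by rw [show -p₁ + 1 = -(p₁ - 1) by ring, dvd_neg]; exact hB
    have h' : ∀ n : ℕ, lensMultiplicity q 1 (-p₁) n = lensMultiplicity q 1 p₂ n := fun n ↦ by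
      rw [lensMultiplicity_neg_right, h n]
    rcases second hp₁.neg_left hp₂ hB' h' with h' | h' | h' | h'
    · exact Or.inr (Or.inl (by rw [show p₁ + p₂ = -(-p₁ - p₂) by ring, dvd_neg]; exact h'))
    · exact Or.inl (by rw [show p₁ - p₂ = -(-p₁ + p₂) by ring, dvd_neg]; exact h')
    · exact Or.inr (Or.inr (Or.inr (by rw [show p₁ * p₂ + 1 = -(-p₁ * p₂ - 1) by ring, dvd_neg]; exact h')))
    · exact Or.inr (Or.inr (Or.inl (by rw [show p₁ * p₂ - 1 = -(-p₁ * p₂ + 1) by ring, dvd_neg]; exact h')))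
  -- `(p₁ ± 1, q) = 1`: the first case of §7
  exact dvd_of_lensMultiplicity_one_eq_of_odd hqo hq3 hp₁ hp₂ (honly hA) (honly hB) h

/-- **THE MAIN THEOREM (Ikeda–Yamamoto 1979) for `q = l^ν`, general weights.** Let `q = l^ν` (`l` an odd prime, `ν ≥ 1`)
and `p₁, p₂, p₁', p₂'` prime to `q`. If `L(q; p₁, p₂)` and `L(q; p₁', p₂')` are isospectral then `p₁p₂' ≡ ±p₁'p₂` or
`p₁p₁' ≡ ±p₂p₂' (mod q)`: the two lens spaces are isometric (Proposition 1.1; reduction to the normalized form via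
`L(q; p₁, p₂) ≅ L(q; 1, p₁*p₂)`, the tree's `lensMultiplicity_eq_one_left`). [cite: IkedaYamamoto1979, Main Theorem
(`q = l^ν`), §4 ("we may assume `p₀ = 1`"), Proposition 1.1] -/
theorem dvd_of_lensMultiplicity_eq_of_prime_pow {q l ν : ℕ} (hq : q = l ^ ν) (hl : l.Prime) (hl2 : l ≠ 2) (hν : ν ≠ 0)
    {p₁ p₂ p₁' p₂' : ℤ} (hp₁ : IsCoprime p₁ q) (hp₂ : IsCoprime p₂ q) (hp₁' : IsCoprime p₁' q) (hp₂' : IsCoprime p₂' q)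
    (h : ∀ n : ℕ, lensMultiplicity q p₁ p₂ n = lensMultiplicity q p₁' p₂' n) :
    (q : ℤ) ∣ p₁ * p₂' - p₁' * p₂ ∨ (q : ℤ) ∣ p₁ * p₂' + p₁' * p₂ ∨
      (q : ℤ) ∣ p₁ * p₁' - p₂ * p₂' ∨ (q : ℤ) ∣ p₁ * p₁' + p₂ * p₂' := by
  obtain ⟨u₁, b₁, hub₁⟩ := hp₁
  obtain ⟨u₁', b₁', hub₁'⟩ := hp₁'
  have hu₁ : (q : ℤ) ∣ u₁ * p₁ - 1 := ⟨-b₁, by linear_combination hub₁⟩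
  have hu₁' : (q : ℤ) ∣ u₁' * p₁' - 1 := ⟨-b₁', by linear_combination hub₁'⟩
  have hcu₁ : IsCoprime u₁ q := ⟨p₁, b₁, by linear_combination hub₁⟩
  have hcu₁' : IsCoprime u₁' q := ⟨p₁', b₁', by linear_combination hub₁'⟩
  have hred : ∀ n : ℕ, lensMultiplicity q 1 (u₁ * p₂) n = lensMultiplicity q 1 (u₁' * p₂') n := fun n ↦ by
    rw [← lensMultiplicity_eq_one_left q hu₁ p₂ n, h n, lensMultiplicity_eq_one_left q hu₁' p₂' n]
  have key := dvd_of_lensMultiplicity_one_eq_of_prime_pow hq hl hl2 hν (hcu₁.mul_left hp₂) (hcu₁'.mul_left hp₂') hred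
  have eU := cast_mul_cast_eq_one_pp hu₁
  have eU' := cast_mul_cast_eq_one_pp hu₁'
  have cast0 : ∀ {t : ℤ}, (q : ℤ) ∣ t → (t : ZMod q) = 0 := fun ht ↦ (ZMod.intCast_zmod_eq_zero_iff_dvd _ _).mpr ht
  rcases key with e | e | e | e
  · have e' := cast0 e
    push_cast at e'
    refine Or.inl ((ZMod.intCast_zmod_eq_zero_iff_dvd _ _).mp ?_)
    push_cast
    linear_combination (-((p₁ : ZMod q) * (p₁' : ZMod q))) * e' + ((p₁' : ZMod q) * (p₂ : ZMod q)) * eU -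
      ((p₁ : ZMod q) * (p₂' : ZMod q)) * eU'
  · have e' := cast0 e
    push_cast at e'
    refine Or.inr (Or.inl ((ZMod.intCast_zmod_eq_zero_iff_dvd _ _).mp ?_))
    push_cast
    linear_combination ((p₁ : ZMod q) * (p₁' : ZMod q)) * e' - ((p₁' : ZMod q) * (p₂ : ZMod q)) * eU -
      ((p₁ : ZMod q) * (p₂' : ZMod q)) * eU'
  · have e' := cast0 e
    push_cast at e'
    refine Or.inr (Or.inr (Or.inl ((ZMod.intCast_zmod_eq_zero_iff_dvd _ _).mp ?_)))
    push_cast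
    linear_combination (-((p₁ : ZMod q) * (p₁' : ZMod q))) * e' +
      ((p₂ : ZMod q) * (p₂' : ZMod q) * (u₁' : ZMod q) * (p₁' : ZMod q)) * eU + ((p₂ : ZMod q) * (p₂' : ZMod q)) * eU'
  · have e' := cast0 e
    push_cast at e'
    refine Or.inr (Or.inr (Or.inr ((ZMod.intCast_zmod_eq_zero_iff_dvd _ _).mp ?_)))
    push_cast
    linear_combination ((p₁ : ZMod q) * (p₁' : ZMod q)) * e' -
      ((p₂ : ZMod q) * (p₂' : ZMod q) * (u₁' : ZMod q) * (p₁' : ZMod q)) * eU - ((p₂ : ZMod q) * (p₂' : ZMod q)) * eU'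

/-- **ISOSPECTRAL ⟺ ISOMETRIC for three-dimensional lens spaces with fundamental group of odd prime-power order `q = l^ν`**
(the Main Theorem of Ikeda–Yamamoto for `q = l^ν`, packaged with its easy converse): for weights prime to `q`, the lens
spaces `L(q; p₁, p₂)` and `L(q; p₁', p₂')` have the same multiplicities `dim E_{n(n+2)}` for all `n` iff they satisfy Ikeda's
isometry criterion `LensWeightsEquivalent` ((4.1)/(4.2), Proposition 1.1); the converse direction is the tree's
`LensWeightsEquivalent.lensSpaceMultiplicity_eq`. [cite: IkedaYamamoto1979, Main Theorem and the Theorem of the Introduction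
(`q = l^ν`), Proposition 1.1, Proposition 4.1] [cite: Ikeda1980, Theorem 2.1] -/
theorem lensMultiplicity_eq_iff_lensWeightsEquivalent_of_prime_pow {q l ν : ℕ} (hq : q = l ^ ν) (hl : l.Prime)
    (hl2 : l ≠ 2) (hν : ν ≠ 0) {p₁ p₂ p₁' p₂' : ℤ} (hp₁ : IsCoprime p₁ q) (hp₂ : IsCoprime p₂ q)
    (hp₁' : IsCoprime p₁' q) (hp₂' : IsCoprime p₂' q) :
    (∀ n : ℕ, lensMultiplicity q p₁ p₂ n = lensMultiplicity q p₁' p₂' n) ↔ LensWeightsEquivalent q ![p₁, p₂] ![p₁', p₂'] := by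
  have hq0 : q ≠ 0 := by rw [hq]; exact pow_ne_zero _ hl.ne_zero
  constructor
  · intro h
    exact (lensWeightsEquivalent_two_iff hp₁').mpr (dvd_of_lensMultiplicity_eq_of_prime_pow hq hl hl2 hν hp₁ hp₂ hp₁' hp₂' h)
  · intro hE n
    have hc : ∀ i : Fin 2, IsCoprime (![p₁, p₂] i) q := fun i ↦ by
      fin_cases i
      · simpa using hp₁
      · simpa using hp₂
    have := LensWeightsEquivalent.lensSpaceMultiplicity_eq (q := q) hq0 hE hc n
    rwa [lensSpaceMultiplicity_two, lensSpaceMultiplicity_two] at this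

end Literature.Analysis.InnerProduct
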